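import Literature.AnabelianGeometry.EtaleTheta.SettingModelChiShearOddLevel
import Literature.AnabelianGeometry.EtaleTheta.SettingModelTateTheta
import Literature.AnabelianGeometry.EtaleTheta.SettingModelTateDeltaTheta
import Literature.AnabelianGeometry.EtaleTheta.SettingModelTateEllCoordinates
import Literature.AnabelianGeometry.EtaleTheta.DoubleUnderline
import HarnessLib

/-!
# The STAGE-2 («Tate shear») model of [EtTh] §1: `Sec2Hyps` and the `E`-free clauses of the choice `X̲̲`
# at `ThetaSetting.modelχq` (R78 cluster, hand #2′q)

Mochizuki, *The étale theta function …*, Publ. RIMS **45** (2009) [EtTh], Def. 2.5 (i) p. 39, Prop. 2.2 (ii)/(iii) p. 37,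
Def. 2.7 p. 41, Prop. 2.12 (i) p. 45 [cite: MochizukiEtTh2009, Def 2.5 (i) p.39]: "`Π_X ↠ Q (≅ ℤ/l)` factors through
`Π^tp_X ↠ Z`", "`Y̲̲ → Y` of degree `l`", "`Ker(Δ^Θ_* ↠ Δ^ell_*) = l·Δ_Θ`".  abc-iut cell, layer L2, prover abc-iut-L2-d1
(gen 5), R78 cluster STAGE 2 (integrator abc-iut-L6-d6), hand #2′q = the stage-2 twin of this seat's
`SettingModelChiDoubleUnderline` / `SettingModelChiThetaDoubleUnderline` over abc-iut-w5-d249's F4q (`PiTpχq`, `actχq`,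
`curveχq`), abc-iut-L2-t5's F5q (`ThetaSetting.modelχq p i j hj`, `YNχq`, `tateTwistData₀`), abc-iut-L6-d6's F1q
(`mem_thetaKerχq_iff`, `mem_ellKerχq_iff`) and `Ẑ`-coordinate `c^t` (`SettingModelThetaCentreZHat`), abc-iut-w5-d051's
`eq_inl_of_right_eq_oneq` (`SettingModelTateEllCoordinates`), and this seat's
odd-level descent of the shear (`SettingModelChiShearOddLevel`: `actχq_mem_dUU`).

The one new point at stage 2: the Tate shear moves `a`, so the stability of the geometric part
`dUU l = {x_l = 0, z_l = 0}` of `Π^tp_X̲̲` under the Galois action is no longer a diagonal computation — it holds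
because `l` is ODD (the shear descends to `Heis(ℤ/l)` and fixes the `y`-axis there).  With that:
* `modelχq_sec2Hyps` — **`Sec2Hyps` HOLDS at `modelχq`** (`K̈ = K`; `Ker(↠ell) ∩ Π^tp_Y ≤ Π^tp_{Y_N}`), `GtpYdd_modelχq`,
  `GK_modelχq`;
* **`Huuχq p i j l hl := dUU l ⋊_{actχq} G_{ℚ_p}`** (`hl : Odd l`) and the five `E`-free `DoubleUnderline` clauses:
  `isOpen_Huuχq`, `map_aug_GtpYdd_inf_Huuχq`, `map_toZ_Huuχq_modelχq` (`= l·ℤ`), **`relIndex_Huuχq_GtpY_modelχq`**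
  (`= l`, orbit–stabiliser for `(γ,σ)•t := z_l(γ) + χ_l(σ)·t` — on degree `0` the action is still the diagonal twist,
  `tateTwistData₀.hlev₀`), **`map_toTheta_Huuχq_modelχq`** (`θ(Π^tp_X̲̲) ∩ Δ_Θ = l·Δ_Θ`, via the `F̂₂`-only
  `Ẑ`-coordinate);
* `EtaleThetaData.doubleUnderlineχqOfEtaRes` — for every `E` over `modelχq`, `X̲̲ := Huuχq` is an `E.DoubleUnderline l`
  given the single `E`-dependent clause `eta_res`.
SEMI-SYNTHETIC MODEL, consistency evidence only; nothing of [EtTh] asserted; no side taken on [IUTchIII] Cor. 3.12.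
-/

noncomputable section

namespace Literature.AnabelianGeometry.EtaleTheta.SettingModel

open Literature.AnabelianGeometry.SemiGraphs _root_.Function
open scoped commutatorElement

variable (p : ℕ) [Fact p.Prime] (i j : ℤ)

/-! ### `Sec2Hyps` at the stage-2 record -/

/-- `Ker(Π^tp_X ↠ (Π^tp_X)^ell) ∩ Π^tp_Y ≤ Π^tp_{Y_N}` at the stage-2 constituents. [cite: MochizukiEtTh2009, §1 p.13] -/
theorem ellKerχq_inf_ker_toZ_le_YNχq (N : ℕ+) :
    CurveTheta.ellKer (curveχq p i j) ⊓ (tateTwistData₀ p i j).toZ.ker ≤ YNχq p i j N := by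
  intro g hg
  obtain ⟨hg1, hgZ⟩ := Subgroup.mem_inf.mp hg
  obtain ⟨hxy, hright⟩ := (mem_ellKerχq_iff p i j g).mp hg1
  rw [MonoidHom.mem_ker, GfpTwistData₀.toZ_apply] at hgZ
  refine (GfpTwistData₀.mem_YN _).mpr ⟨⟨hgZ, ?_⟩, ?_⟩
  · change levelHom N g.left ∈ (Heis.zAxis : Subgroup (Heis (ZMod N)))
    exact hxy N
  · rw [hright]
    exact Subgroup.one_mem _

variable (hj : Even j)

/-- **The stage-2 model satisfies `Sec2Hyps`** (`K = K̈ = ℚ_p`; `Ker(↠ell) ∩ Π^tp_Y ≤ Π^tp_{Y_N}`).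
[cite: MochizukiEtTh2009, Def 2.5 p.39] -/
theorem _root_.Literature.AnabelianGeometry.EtaleTheta.ThetaSetting.modelχq_sec2Hyps :
    (ThetaSetting.modelχq p i j hj).Sec2Hyps where
  Kdd_eq := by
    change fieldKN ⊥ (qModel p) 2 = ⊥
    exact fieldKN_bot_qModel_two p
  ker_toEll_le_GtpYN N := by
    change ((CurveTheta.thetaToEll (curveχq p i j)).comp (CurveTheta.toTheta (curveχq p i j))).ker ⊓
      (tateTwistData₀ p i j).toZ.ker ≤ YNχq p i j N
    rw [CurveTheta.ker_toEll]
    exact ellKerχq_inf_ker_toZ_le_YNχq p i j N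

/-- `Π^tp_Ÿ = Π^tp_{Y₂}` at the stage-2 model. [cite: MochizukiEtTh2009, §1 p.17] -/
theorem GtpYdd_modelχq : (ThetaSetting.modelχq p i j hj).GtpYdd = YNχq p i j 2 :=
  ThetaSetting.GtpYdd_eq_GtpYN_two (ThetaSetting.modelχq_sec2Hyps p i j hj)

/-- `G_K = G_{ℚ_p}` at the stage-2 model. [cite: MochizukiEtTh2009, §1 p.11] -/
theorem GK_modelχq : (ThetaSetting.modelχq p i j hj).GK = ⊤ :=
  IntermediateField.fixingSubgroup_bot

variable {hj}

/-! ### `Π^tp_X̲̲ := dUU l ⋊ G_{ℚ_p}` at stage 2 (odd `l`) -/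

/-- **`Π^tp_X̲̲` in the stage-2 model**: `dUU l ⋊_{actχq} G_{ℚ_p}` — well defined for ODD `l` (`actχq_mem_dUU`).
[cite: MochizukiEtTh2009, Def 2.5 (i) p.39] -/
def Huuχq (l : ℕ+) (hl : Odd (l : ℕ)) : Subgroup (PiTpχq p i j) :=
  Semidirect.twistedProd (dUU l) ⊤ (Semidirect.stable_of_forall (actχq_mem_dUU p i j l hl) ⊤)

variable (l : ℕ+) (hl : Odd (l : ℕ))

/-- Membership in `Π^tp_X̲̲`: `ĥ_l(pr₁ g.left)` has `x = 0` and `z = 0`. [cite: MochizukiEtTh2009, Def 2.5 (i) p.39] -/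
theorem mem_Huuχq_iff (g : PiTpχq p i j) :
    g ∈ Huuχq p i j l hl ↔ (levelHom l g.left).x = 0 ∧ (levelHom l g.left).z = 0 := by
  change g.left ∈ dUU l ∧ g.right ∈ (⊤ : Subgroup (GQp p)) ↔ _
  rw [and_iff_left (Subgroup.mem_top _)]
  rfl

/-- `inl γ ∈ Π^tp_X̲̲ ↔ γ ∈ dUU l`. [cite: MochizukiEtTh2009, Def 2.5 (i) p.39] -/
theorem inl_mem_Huuχq_iff (γ : Gfp) : (SemidirectProduct.inl γ : PiTpχq p i j) ∈ Huuχq p i j l hl ↔ γ ∈ dUU l := by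
  rw [mem_Huuχq_iff, SemidirectProduct.left_inl]
  rfl

/-- `inr σ ∈ Π^tp_X̲̲`. [cite: MochizukiEtTh2009, Prop 2.2 (iii) p.37] -/
theorem inr_mem_Huuχq (σ : GQp p) : (SemidirectProduct.inr σ : PiTpχq p i j) ∈ Huuχq p i j l hl := by
  rw [mem_Huuχq_iff, SemidirectProduct.left_inr, map_one]
  exact ⟨rfl, rfl⟩

/-- **`Π^tp_X̲̲` is open.** [cite: MochizukiEtTh2009, Def 2.5 (i) p.39] -/
theorem isOpen_Huuχq : IsOpen (Huuχq p i j l hl : Set (PiTpχq p i j)) :=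
  Semidirect.isOpen_twistedProd (continuous_leftRightχq p i j) (isOpen_dUU l)
    (by rw [Subgroup.coe_top]; exact isOpen_univ)

/-- `inr σ ∈ Π^tp_{Y_N}` for `σ ∈ G_{K_N}` (stage 2). [cite: MochizukiEtTh2009, §1 p.13] -/
theorem inr_mem_YNχq (N : ℕ+) {σ : GQp p} (hσ : σ ∈ (fieldKN ⊥ (qModel p) N).fixingSubgroup) :
    (SemidirectProduct.inr σ : PiTpχq p i j) ∈ YNχq p i j N :=
  (GfpTwistData₀.mem_YN _).mpr
    ⟨by rw [SemidirectProduct.left_inr]; exact Subgroup.one_mem _,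
     by rw [SemidirectProduct.right_inr]; exact hσ⟩

/-- **`(Π^tp_{Y₂} ∩ Π^tp_X̲̲) ↠ G_{ℚ_p}`** at the stage-2 constituents. [cite: MochizukiEtTh2009, Prop 2.2 (iii) p.37] -/
theorem map_augχq_YNχq_two_inf_Huuχq :
    (YNχq p i j 2 ⊓ Huuχq p i j l hl).map (augχq p i j).toMonoidHom = ⊤ := by
  refine eq_top_iff.mpr fun σ _ => ?_
  refine ⟨SemidirectProduct.inr σ, Subgroup.mem_inf.mpr ⟨inr_mem_YNχq p i j 2 ?_, inr_mem_Huuχq p i j l hl σ⟩, rfl⟩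
  rw [fieldKN_bot_qModel_two, IntermediateField.fixingSubgroup_bot]
  exact Subgroup.mem_top σ

/-- **`Π^tp_Ÿ ∩ Π^tp_X̲̲ ↠ G_K`** at the stage-2 record. [cite: MochizukiEtTh2009, Prop 2.2 (iii) p.37] -/
theorem map_aug_GtpYdd_inf_Huuχq :
    ((ThetaSetting.modelχq p i j hj).GtpYdd ⊓ Huuχq p i j l hl).map (ThetaSetting.modelχq p i j hj).aug.toMonoidHom =
      (ThetaSetting.modelχq p i j hj).GK := by
  rw [GtpYdd_modelχq, GK_modelχq]
  exact map_augχq_YNχq_two_inf_Huuχq p i j l hl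

/-- **`toZ(Π^tp_X̲̲) = l·ℤ`** at the stage-2 record (witness `(η(a^l), l)`). [cite: MochizukiEtTh2009, Def 2.5 (i) p.39] -/
theorem map_toZ_Huuχq_modelχq :
    (Huuχq p i j l hl).map (ThetaSetting.modelχq p i j hj).toZ = Subgroup.zpowers (Multiplicative.ofAdd ((l : ℕ) : ℤ)) := by
  apply le_antisymm
  · rintro _ ⟨g, hg, rfl⟩
    obtain ⟨⟨k, hk⟩, -⟩ := (mem_dUU_iff_dvd l g.left).mp (Semidirect.mem_twistedProd.mp hg).1
    change gfpSnd g.left ∈ _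
    rw [Subgroup.mem_zpowers_iff]
    refine ⟨k, ?_⟩
    rw [← ofAdd_zsmul, smul_eq_mul, ← ofAdd_toAdd (gfpSnd g.left), hk, mul_comm]
  · rw [Subgroup.zpowers_le]
    refine ⟨SemidirectProduct.inl (gfpOf (FreeGroup.of 0 ^ ((l : ℕ) : ℤ))), ?_, ?_⟩
    · rw [SetLike.mem_coe, inl_mem_Huuχq_iff, mem_dUU_iff, levelHom_gfpOf_of_zero_zpow]
      exact ⟨by simp, rfl⟩
    · change gfpSnd (SemidirectProduct.inl (gfpOf (FreeGroup.of 0 ^ ((l : ℕ) : ℤ))) : PiTpχq p i j).left = _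
      rw [SemidirectProduct.left_inl, gfpSnd_gfpOf, expA_of_zero_zpow]

/-! ### `[Π^tp_Y : Π^tp_Y ∩ Π^tp_X̲̲] = l` at stage 2 -/

/-- **`[Π^tp_Y : Π^tp_Y ∩ Π^tp_X̲̲] = l`** at the stage-2 constituents: orbit–stabiliser for the transitive affine action
`(γ, σ) • t := z_l(γ) + χ_l(σ)·t` of `Π^tp_Y` on `ℤ/l` — on degree `0` the stage-2 action is still the diagonal twist
(`tateTwistData₀.hlev₀`), so the stage-1 computation transfers verbatim. [cite: MochizukiEtTh2009, Def 2.7 p.41] -/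
theorem relIndex_Huuχq_inf_ker_toZ :
    (Huuχq p i j l hl ⊓ (tateTwistData₀ p i j).toZ.ker).relIndex (tateTwistData₀ p i j).toZ.ker = l := by
  have hker : ∀ g : (tateTwistData₀ p i j).toZ.ker, gfpSnd (g : PiTpχq p i j).left = 1 := fun g => by
    have h := g.2
    rwa [MonoidHom.mem_ker, GfpTwistData₀.toZ_apply] at h
  have hx : ∀ g : (tateTwistData₀ p i j).toZ.ker, (levelHom l (g : PiTpχq p i j).left).x = 0 := fun g =>
    levelHom_x_eq_zero (hker g)
  letI : SMul (tateTwistData₀ p i j).toZ.ker (ZMod l) :=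
    ⟨fun g t => (levelHom l (g : PiTpχq p i j).left).z + ZHatLevel.levelChar l (chi p (g : PiTpχq p i j).right) * t⟩
  have smul_def : ∀ (g : (tateTwistData₀ p i j).toZ.ker) (t : ZMod l),
      g • t = (levelHom l (g : PiTpχq p i j).left).z + ZHatLevel.levelChar l (chi p (g : PiTpχq p i j).right) * t :=
    fun _ _ => rfl
  letI : MulAction (tateTwistData₀ p i j).toZ.ker (ZMod l) :=
    { one_smul := fun t => by
        simp only [smul_def, OneMemClass.coe_one, SemidirectProduct.one_left, SemidirectProduct.one_right,
          map_one, Heis.one_z, zero_add, one_mul]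
      mul_smul := fun g h t => by
        have hlev : levelHom l (actχq p i j (g : PiTpχq p i j).right (h : PiTpχq p i j).left) =
            Heis.diagTwist (ZHatLevel.levelChar l (chi p (g : PiTpχq p i j).right)) (levelHom l (h : PiTpχq p i j).left) :=
          (tateTwistData₀ p i j).hlev₀ l _ _ (hker h)
        simp only [smul_def, MulMemClass.coe_mul, SemidirectProduct.mul_left, SemidirectProduct.mul_right,
          map_mul, Heis.mul_z, hlev, Heis.diagTwist_apply, hx g, zero_mul, add_zero]
        ring }
  have hstab : (Huuχq p i j l hl ⊓ (tateTwistData₀ p i j).toZ.ker).subgroupOf (tateTwistData₀ p i j).toZ.ker =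
      MulAction.stabilizer (tateTwistData₀ p i j).toZ.ker (0 : ZMod l) := by
    ext g
    rw [Subgroup.mem_subgroupOf, MulAction.mem_stabilizer_iff, smul_def, mul_zero, add_zero, Subgroup.mem_inf,
      mem_Huuχq_iff]
    exact ⟨fun h => h.1.2, fun h => ⟨⟨hx g, h⟩, g.2⟩⟩
  have horb : MulAction.orbit (tateTwistData₀ p i j).toZ.ker (0 : ZMod l) = Set.univ := by
    refine Set.eq_univ_of_forall fun t => ?_
    obtain ⟨k, hk⟩ := ZMod.intCast_surjective t
    have hmem : (SemidirectProduct.inl (gfpOf (⁅FreeGroup.of (0 : Fin 2), FreeGroup.of 1⁆ ^ k)) : PiTpχq p i j) ∈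
        (tateTwistData₀ p i j).toZ.ker := by
      rw [MonoidHom.mem_ker, GfpTwistData₀.toZ_apply, SemidirectProduct.left_inl]
      exact gfpOf_commutator_zpow_mem_ker k
    rw [MulAction.mem_orbit_iff]
    refine ⟨⟨_, hmem⟩, ?_⟩
    rw [smul_def, mul_zero, add_zero, Subgroup.coe_mk, SemidirectProduct.left_inl,
      levelHom_gfpOf_commutator_zpow]
    exact hk
  rw [Subgroup.relIndex, hstab, MulAction.index_stabilizer, horb, Set.ncard_univ, Nat.card_zmod]

/-- **`[Π^tp_Y : Π^tp_Y ∩ Π^tp_X̲̲] = l`** at the stage-2 record. [cite: MochizukiEtTh2009, Def 2.7 p.41] -/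
theorem relIndex_Huuχq_GtpY_modelχq :
    (Huuχq p i j l hl ⊓ (ThetaSetting.modelχq p i j hj).GtpY).relIndex (ThetaSetting.modelχq p i j hj).GtpY = l :=
  relIndex_Huuχq_inf_ker_toZ p i j l hl

/-! ### `θ(Π^tp_X̲̲) ∩ Δ_Θ = l·Δ_Θ` at stage 2 -/

/-- **`(Δ_Θ)^l ⊆ θ(Π^tp_X̲̲)`** at stage 2. [cite: MochizukiEtTh2009, Prop 2.12 (i) p.45] -/
theorem pow_mem_map_toTheta_Huuχq {y : CurveTheta.GTheta (curveχq p i j)}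
    (hy : y ∈ (CurveTheta.thetaToEll (curveχq p i j)).ker) :
    y ^ (l : ℕ) ∈ (Huuχq p i j l hl).map (CurveTheta.toTheta (curveχq p i j)) := by
  obtain ⟨g, hg, rfl⟩ := CurveTheta.exists_eq_toTheta_of_mem_ker_thetaToEll _ hy
  obtain ⟨hxy, hright⟩ := (mem_ellKerχq_iff p i j g).mp hg
  refine ⟨g ^ (l : ℕ), ?_, map_pow _ _ _⟩
  rw [SetLike.mem_coe, mem_Huuχq_iff, eq_inl_of_right_eq_oneq p i j hright, ← map_pow, SemidirectProduct.left_inl,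
    map_pow, Heis.pow_eq_of_x_eq_zero (levelHom l g.left) (hxy l).1]
  refine ⟨rfl, ?_⟩
  change ((l : ℕ) : ZMod l) * _ = 0
  rw [ZMod.natCast_self, zero_mul]

/-- **`θ(Π^tp_X̲̲) ∩ Δ_Θ ⊆ (Δ_Θ)^l`** at stage 2 (the `F̂₂`-only `Ẑ`-coordinate argument of stage 1, verbatim).
[cite: MochizukiEtTh2009, Prop 2.12 (i) p.45] -/
theorem exists_pow_eq_of_mem_map_toTheta_Huuχq {x : CurveTheta.GTheta (curveχq p i j)}
    (hx : x ∈ (Huuχq p i j l hl).map (CurveTheta.toTheta (curveχq p i j)))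
    (hxΔ : x ∈ (CurveTheta.thetaToEll (curveχq p i j)).ker) :
    ∃ y ∈ (CurveTheta.thetaToEll (curveχq p i j)).ker, y ^ (l : ℕ) = x := by
  obtain ⟨g, hg, rfl⟩ := hx
  have hgE : g ∈ CurveTheta.ellKer (curveχq p i j) := (CurveTheta.mk_mem_ker_thetaToEll_iff _ g).mp hxΔ
  obtain ⟨hxy, hright⟩ := (mem_ellKerχq_iff p i j g).mp hgE
  obtain ⟨-, hz⟩ := (mem_Huuχq_iff p i j l hl g).mp hg
  have hxcl : gfpFst g.left ∈ (⁅(⊤ : Subgroup F₂hatT), (⊤ : Subgroup F₂hatT)⁆).topologicalClosure :=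
    (mem_closure_commutator₂_iff_forall_hHat _).mpr hxy
  obtain ⟨f, hf⟩ := exists_cPow
  obtain ⟨t, -, htN⟩ := exists_mul_inv_cPow_mem_closure₃ f hf hxcl
  have hlev : ZHatLevel.level l t = 1 := by
    change (hHat l (gfpFst g.left)).z = 0 at hz
    rw [htN l] at hz
    dsimp only at hz
    rw [← modN_eq_level, ← ofAdd_toAdd (modN l t), hz, ofAdd_zero]
  obtain ⟨s, hs⟩ := (ZHatLevel.level_eq_one_iff_exists_pow l t).mp hlev
  have hmem : ((f s, (1 : Multiplicative ℤ)) : F₂hatT × Multiplicative ℤ) ∈ Gfp := by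
    rw [mem_Gfp, map_one]
    exact eHat_apply_of_cPowSpec f hf s
  have hγs : gfpFst ⟨(f s, 1), hmem⟩ = f s := rfl
  have hinl : (SemidirectProduct.inl ⟨(f s, 1), hmem⟩ : PiTpχq p i j) ∈ CurveTheta.ellKer (curveχq p i j) := by
    rw [mem_ellKerχq_iff, SemidirectProduct.left_inl, SemidirectProduct.right_inl, hγs]
    exact ⟨fun N => by rw [hHat_apply_of_cPowSpec f hf]; exact ⟨rfl, rfl⟩, rfl⟩
  refine ⟨CurveTheta.toTheta (curveχq p i j) (SemidirectProduct.inl ⟨(f s, 1), hmem⟩),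
    (CurveTheta.mk_mem_ker_thetaToEll_iff _ _).mpr hinl, ?_⟩
  rw [← map_pow, CurveTheta.toTheta, QuotientGroup.mk'_apply, QuotientGroup.mk'_apply, QuotientGroup.eq,
    mem_thetaKerχq_iff, eq_inl_of_right_eq_oneq p i j hright, ← map_pow, ← map_inv, ← map_mul,
    SemidirectProduct.left_inl, SemidirectProduct.right_inl]
  refine ⟨fun N => ?_, rfl⟩
  rw [map_mul, map_inv, map_pow, hγs, ← map_pow, hs, map_mul, map_inv, htN N, hHat_apply_of_cPowSpec f hf,
    inv_mul_cancel]

/-- **`θ(Π^tp_X̲̲) ∩ Δ_Θ = l·Δ_Θ`** at the stage-2 record. [cite: MochizukiEtTh2009, Prop 2.12 (i) p.45] -/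
theorem map_toTheta_Huuχq_modelχq :
    (Huuχq p i j l hl).map (ThetaSetting.modelχq p i j hj).toTheta ⊓ (ThetaSetting.modelχq p i j hj).DeltaTheta =
      (ThetaSetting.modelχq p i j hj).lDeltaTheta l := by
  ext x
  constructor
  · intro h
    obtain ⟨hx, hxΔ⟩ := Subgroup.mem_inf.mp h
    exact exists_pow_eq_of_mem_map_toTheta_Huuχq p i j l hl hx hxΔ
  · rintro ⟨y, hy, rfl⟩
    exact Subgroup.mem_inf.mpr ⟨pow_mem_map_toTheta_Huuχq p i j l hl hy, pow_mem hy _⟩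

/-! ### The choice `X̲̲` for an étale-theta datum over the stage-2 model, modulo `eta_res` -/

/-- `Δ_Θ ⊴ (Π^tp_X)^Θ` at the stage-2 record — the generic instance re-exported at the concrete key (so that the
cocycle-level clause below can be STATED at `modelχq`). [cite: MochizukiEtTh2009, §1 p.12] -/
instance deltaTheta_modelχq_normal : (ThetaSetting.modelχq p i j hj).DeltaTheta.Normal :=
  ThetaSetting.deltaTheta_normal _

/-- `Δ_Θ` is commutative at the stage-2 record (instance key). [cite: MochizukiEtTh2009, §1 p.12] -/
instance deltaTheta_modelχq_isMulCommutative : IsMulCommutative (ThetaSetting.modelχq p i j hj).DeltaTheta :=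
  ThetaSetting.deltaTheta_comm _

/-- **`X̲̲ := Huuχq` is an `E.DoubleUnderline l` for every étale-theta datum `E` over the stage-2 model**, given the single
`E`-dependent clause `eta_res`. [cite: MochizukiEtTh2009, Def 2.7 p.41] -/
def _root_.Literature.AnabelianGeometry.EtaleTheta.ThetaSetting.EtaleThetaData.doubleUnderlineχqOfEtaRes
    (E : (ThetaSetting.modelχq p i j hj).EtaleThetaData)
    (heta : ∃ (f : ↥((ThetaSetting.modelχq p i j hj).GtpYdd ⊓ Huuχq p i j l hl) → (ThetaSetting.modelχq p i j hj).DeltaTheta)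
        (hf : f ∈ contCocycles (ThetaSetting.modelχq p i j hj).toTheta (ThetaSetting.modelχq p i j hj).DeltaTheta
          ((ThetaSetting.modelχq p i j hj).GtpYdd ⊓ Huuχq p i j l hl)),
        (∀ g, (f g : (ThetaSetting.modelχq p i j hj).GtpTheta) ∈ (ThetaSetting.modelχq p i j hj).lDeltaTheta l) ∧
          ContH1.mk f hf = ContH1.res (ThetaSetting.modelχq p i j hj).toTheta (ThetaSetting.modelχq p i j hj).DeltaTheta
            inf_le_left E.etaDd) :
    E.DoubleUnderline l where
  l_odd := hl
  Huu := Huuχq p i j l hl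
  isOpen_Huu := isOpen_Huuχq p i j l hl
  map_aug_Ydduu := map_aug_GtpYdd_inf_Huuχq p i j l hl
  map_toZ_Huu := map_toZ_Huuχq_modelχq p i j l hl
  relIndex_Huu_GtpY := relIndex_Huuχq_GtpY_modelχq p i j l hl
  map_toTheta_Huu := map_toTheta_Huuχq_modelχq p i j l hl
  eta_res := heta

end Literature.AnabelianGeometry.EtaleTheta.SettingModel

end
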